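import Literature.LinearAlgebra.Matrix.RowLatticeSelection
import Literature.Computability.Complexity.DeterminantFP
import Literature.Computability.Complexity.CodeFPLists
import HarnessLib

/-!
# The selection of short independent lattice vectors is polynomial time (typed `FP` on codes)

Topic `Literature/Computability/Complexity`; the machine side of
`Literature/LinearAlgebra/Matrix/RowLatticeSelection.lean` (the list programs `RowSelect.memTest`,
`indepTest`, `greedy`, `selectBest`, `post` of the post-processing of Regev's `GIVP ≤ DGS`
reduction, parametrised by a determinant routine `D`) with the polynomial-time integer determinant
`IntDetFP.detZ` of `DeterminantFP.lean` plugged in (`detCorrect_detZ : RowSelect.DetCorrect detZ`).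
Every program is run on codes by a polynomial-time string function assembled from the combinators
of `CodeFP.lean` / `CodeFPArith.lean` / `CodeFPLists.lean`:

* `idot_codeFP` (the accumulator of the sum is shorter than the code of the list,
  `length_intE_foldl_add_le`), `normSq_codeFP`, `gram_codeFP`, `indepTest_codeFP`, `memTest_codeFP`
  (divisibility as `x = d · (x / d)`), `greedy_codeFP` (the kept list is a sublist of the scanned
  one), `maxNormSq_codeFP` (the running maximum is one of the items), `selectBest_codeFP` (the
  incumbent is the fallback or a candidate), `filter_codeFP` (a generic `filter`, as
  `flatten ∘ map`), `candidates_codeFP`, and **`post_codeFP`**.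

So the whole deterministic post-processing of Regev 2009, Lemma 3.17 — given the dimension, the
basis, the fallback basis and the groups of sampled vectors as codes — is one `FP` string function.

## References

* O. Regev, *On lattices, learning with errors, random linear codes, and cryptography*, J. ACM 56
  (2009), art. 34, Lemma 3.17 (proof) [Regev2009].
* [AroraBarak2009] S. Arora, B. Barak, *Computational Complexity: A Modern Approach*, CUP 2009,
  §1.3 (closure of polynomial time under composition and bounded loops).
-/

namespace Literature.Computability.Complexity

namespace RowSelectFP

open CodeFP Polynomial _root_.Computability Brick Literature.LinearAlgebra.Matrix
  Literature.LinearAlgebra.Matrix.RowSelect IntDetFP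

/-- Integer vectors: raw lists of canonical integer codes. -/
local notation "ivecE" => rawE intE

/-- Integer matrices: raw lists of rows. -/
local notation "zmatE" => rawE (rawE intE)

/-! ### The determinant routine -/

/-- **The polynomial-time determinant is a determinant routine.** [folklore] -/
theorem detCorrect_detZ : DetCorrect detZ := ⟨fun M => detZ_rows M⟩

/-! ### Sizes of integers and sums -/

/-- An integer below `2^L` in absolute value has a code of length `≤ 3L + 2`. [folklore] -/
theorem length_intE_le_of_natAbs_lt {z : ℤ} {L : ℕ} (h : z.natAbs < 2 ^ L) : (intE z).length ≤ 3 * L + 2 := by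
  have h1 := length_dpEnc_le z
  have h2 : z.natAbs.size ≤ L := Nat.size_le.2 h
  change (dpEnc z).length ≤ _
  omega

/-- The sum of the magnitudes of a list of integers is below `2^{|code|}`. [folklore] -/
theorem sum_natAbs_lt_two_pow (l : List ℤ) : (l.map Int.natAbs).sum < 2 ^ (rawE intE l).length := by
  induction l with
  | nil => simp
  | cons a l ih =>
    rw [List.map_cons, List.sum_cons, rawE_cons, length_boolPair]
    have ha := natAbs_lt_two_pow_length a
    have h1 : 2 ^ (intE a).length + 2 ^ (rawE intE l).length ≤ 2 ^ (2 * (intE a).length + 2 + (rawE intE l).length) := by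
      have e1 : 2 ^ (intE a).length ≤ 2 ^ (2 * (intE a).length + 1 + (rawE intE l).length) :=
        Nat.pow_le_pow_right (by norm_num) (by omega)
      have e2 : 2 ^ (rawE intE l).length ≤ 2 ^ (2 * (intE a).length + 1 + (rawE intE l).length) :=
        Nat.pow_le_pow_right (by norm_num) (by omega)
      have e3 : 2 ^ (2 * (intE a).length + 2 + (rawE intE l).length) =
          2 * 2 ^ (2 * (intE a).length + 1 + (rawE intE l).length) := by
        rw [show 2 * (intE a).length + 2 + (rawE intE l).length = (2 * (intE a).length + 1 + (rawE intE l).length) + 1 by omega,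
          pow_succ]; ring
      omega
    omega

/-- A left fold of additions is bounded by the magnitudes. [folklore] -/
theorem natAbs_foldl_add_le (l : List ℤ) (a : ℤ) : (l.foldl (· + ·) a).natAbs ≤ a.natAbs + (l.map Int.natAbs).sum := by
  induction l generalizing a with
  | nil => simp
  | cons x l ih =>
    rw [List.foldl_cons, List.map_cons, List.sum_cons]
    have := ih (a + x)
    have h2 : (a + x).natAbs ≤ a.natAbs + x.natAbs := Int.natAbs_add_le a x
    omega

/-- **The accumulator of a sum is short**: `|intE (∑ l₁)| ≤ 3 |rawE intE (l₁ ++ l₂)| + 2`. [folklore] -/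
theorem length_intE_foldl_add_le (l₁ l₂ : List ℤ) :
    (intE (l₁.foldl (· + ·) 0)).length ≤ 3 * (rawE intE (l₁ ++ l₂)).length + 2 := by
  apply length_intE_le_of_natAbs_lt
  have h1 := natAbs_foldl_add_le l₁ 0
  have h2 := sum_natAbs_lt_two_pow l₁
  have h3 : 2 ^ (rawE intE l₁).length ≤ 2 ^ (rawE intE (l₁ ++ l₂)).length :=
    Nat.pow_le_pow_right (by norm_num) (by rw [rawE_append, List.length_append]; omega)
  simp only [Int.natAbs_zero, zero_add] at h1
  omega

/-! ### Dot products, norms, Gram matrices -/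

/-- **The integer dot product on codes.** [cite: AroraBarak2009, §1.3] -/
theorem idot_codeFP : CodeFP (pairE ivecE ivecE) intE (fun p => idot p.1 p.2) := by
  have hzip := zipWith (σ := Unit) (eσ := unitE) (eα := intE) (eβ := intE) (eγ := intE)
    (g := fun t : Unit × ℤ × ℤ => t.2.1 * t.2.2) (intMul.comp (snd _ _))
  have hz : CodeFP (pairE ivecE ivecE) ivecE (fun p => List.zipWith (· * ·) p.1 p.2) :=
    (hzip.comp ((const _ ()).pair (CodeFP.id _))).congr fun _ => rfl
  have hstep : CodeFP (pairE intE intE) intE (fun t => t.2 + t.1) := (intAdd.comp ((snd _ _).pair (fst _ _))).congr fun _ => rfl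
  have hfold := foldl₀ (α := ℤ) (β := ℤ) (eα := intE) (eβ := intE) (step := fun a b => b + a) (b₀ := 0) hstep
    (3 * X + 2) (fun l₁ l₂ => by
      have h := length_intE_foldl_add_le l₁ l₂
      simp only [eval_add, eval_mul, eval_ofNat, eval_X]
      exact h)
  refine (hfold.comp hz).congr fun p => ?_
  rw [idot, Berkowitz.dot]
  rfl

/-- **The squared norm on codes.** [cite: AroraBarak2009, §1.3] -/
theorem normSq_codeFP : CodeFP ivecE intE normSq :=
  (idot_codeFP.comp ((CodeFP.id _).pair (CodeFP.id _))).congr fun _ => rfl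

/-- **The Gram matrix on codes** (a `map` of a `map` of `idot`). [cite: AroraBarak2009, §1.3] -/
theorem gram_codeFP : CodeFP zmatE zmatE gram := by
  have hinner := map (σ := List ℤ) (eσ := ivecE) (eα := ivecE) (g := fun q : List ℤ × List ℤ => idot q.1 q.2) idot_codeFP
  -- `(u, T) ↦ T.map (idot u ·)`; then over `T` with context `T`
  have hrow : CodeFP (pairE zmatE ivecE) ivecE (fun q => q.1.map fun w => idot q.2 w) :=
    (hinner.comp ((snd _ _).pair (fst _ _))).congr fun _ => rfl
  have houter := map (σ := List (List ℤ)) (eσ := zmatE) (eα := ivecE) hrow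
  exact (houter.comp ((CodeFP.id _).pair (CodeFP.id _))).congr fun _ => rfl

/-! ### The tests -/

/-- **The independence test on codes.** [cite: AroraBarak2009, §1.3] -/
theorem indepTest_codeFP : CodeFP zmatE bitE (indepTest detZ) := by
  have h := CodeFP.not (intEq.comp ((detZ_codeFP.comp gram_codeFP).pair (const _ (0 : ℤ))))
  refine h.congr fun T => ?_
  rw [indepTest, decide_not]

/-- Divisibility as an equation: `d ∣ x ↔ x = d (x / d)`. [folklore] -/
theorem dvd_iff_eq_mul_ediv (d x : ℤ) : d ∣ x ↔ x = d * (x / d) := by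
  constructor
  · intro h; exact (Int.mul_ediv_cancel' h).symm
  · intro h; exact ⟨x / d, h⟩

/-- **The membership test on codes** (`det B ≠ 0` and, over `i < |B|`, `det B ∣ det (B[i ← v])`).
[cite: AroraBarak2009, §1.3] -/
theorem memTest_codeFP : CodeFP (pairE zmatE ivecE) bitE (fun p => memTest detZ p.1 p.2) := by
  let iE := pairE (rawE ivecE) ivecE
  have pB : CodeFP iE zmatE (fun p => p.1) := fst _ _
  have pv : CodeFP iE ivecE (fun p => p.2) := snd _ _
  have hdB : CodeFP iE intE (fun p => detZ p.1) := detZ_codeFP.comp pB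
  have hne : CodeFP iE bitE (fun p => decide (detZ p.1 ≠ 0)) :=
    (CodeFP.not (intEq.comp (hdB.pair (const _ (0 : ℤ))))).congr fun _ => by rw [decide_not]
  have hrange : CodeFP iE (rawE natE) (fun p => List.range p.1.length) := urange.comp ((ulength ivecE).comp pB)
  -- context `(B, v, det B)`, item `i`
  let cE := pairE zmatE (pairE ivecE intE)
  have hctx : CodeFP iE cE (fun p => (p.1, p.2, detZ p.1)) := pB.pair (pv.pair hdB)
  let tE := pairE cE natE
  have qB : CodeFP tE zmatE (fun t => t.1.1) := (fst _ _).fst'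
  have qv : CodeFP tE ivecE (fun t => t.1.2.1) := (fst _ _).snd'.fst'
  have qd : CodeFP tE intE (fun t => t.1.2.2) := (fst _ _).snd'.snd'
  have qi : CodeFP tE natE (fun t => t.2) := snd _ _
  have hset : CodeFP tE zmatE (fun t => t.1.1.set t.2 t.1.2.1) := (setAt ivecE).comp (qB.pair (qi.pair qv))
  have hx : CodeFP tE intE (fun t => detZ (t.1.1.set t.2 t.1.2.1)) := detZ_codeFP.comp hset
  have hdvd : CodeFP tE bitE (fun t => decide (detZ (t.1.1.set t.2 t.1.2.1) = t.1.2.2 * (detZ (t.1.1.set t.2 t.1.2.1) / t.1.2.2))) :=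
    (intEq.comp (hx.pair (intMul.comp (qd.pair (intEDiv.comp (hx.pair qd)))))).congr fun _ => rfl
  have hall := all (σ := List (List ℤ) × List ℤ × ℤ) (eσ := cE) (eα := natE) hdvd
  have h := hne.and (hall.comp (hctx.pair hrange))
  refine h.congr fun p => ?_
  simp only [memTest]
  congr 1
  exact List.all_congr rfl fun i => decide_eq_decide.2 (dvd_iff_eq_mul_ediv _ _).symm

/-! ### The greedy selection -/

/-- **One greedy step on codes.** [cite: Regev2009, Lemma 3.17 (proof)] -/
theorem greedyStep_codeFP :
    CodeFP (pairE natE (pairE ivecE zmatE)) zmatE (fun t => greedyStep detZ t.1 t.2.2 t.2.1) := by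
  let iE := pairE natE (pairE ivecE zmatE)
  have pn : CodeFP iE natE (fun t => t.1) := fst _ _
  have pv : CodeFP iE ivecE (fun t => t.2.1) := (snd _ _).fst'
  have pT : CodeFP iE zmatE (fun t => t.2.2) := (snd _ _).snd'
  have happ : CodeFP iE zmatE (fun t => t.2.2 ++ [t.2.1]) := (rawAppend ivecE).comp (pT.pair ((rawSingleton ivecE).comp pv))
  have hlt : CodeFP iE bitE (fun t => decide (t.2.2.length < t.1)) := natLt.comp (((natLength ivecE).comp pT).pair pn)
  have hind : CodeFP iE bitE (fun t => indepTest detZ (t.2.2 ++ [t.2.1])) := indepTest_codeFP.comp happ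
  exact ((hlt.and hind).ite happ pT).congr fun _ => rfl

/-- **The greedy selection on codes** (a left fold whose accumulator is a sublist of the scanned
list). [cite: Regev2009, Lemma 3.17 (proof)] [cite: AroraBarak2009, §1.3] -/
theorem greedy_codeFP : CodeFP (pairE natE zmatE) zmatE (fun t => greedy detZ t.1 t.2) := by
  have hstep : CodeFP (pairE natE (pairE ivecE zmatE)) zmatE (fun t => greedyStep detZ t.1 t.2.2 t.2.1) := greedyStep_codeFP
  have hfold := foldl (σ := ℕ) (α := List ℤ) (β := List (List ℤ)) (eσ := natE) (eα := ivecE) (eβ := zmatE)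
    (step := fun n v T => greedyStep detZ n T v) (init := fun _ => []) hstep (const _ []) X (fun n l₁ l₂ => by
      have hsub : (l₁.foldl (fun T v => greedyStep detZ n T v) []).Sublist l₁ := greedy_sublist detZ n l₁
      have h1 := length_rawE_le_of_sublist ivecE hsub
      have h2 : (rawE ivecE l₁).length ≤ (rawE ivecE (l₁ ++ l₂)).length := by
        rw [rawE_append, List.length_append]; omega
      simp only [eval_X, pairE_apply, length_boolPair]
      omega)
  exact hfold.congr fun _ => rfl

/-! ### The selection of the shortest candidate -/

/-- A left fold of `max` is the start or one of the items. [folklore] -/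
theorem foldl_max_mem (l : List ℤ) (a : ℤ) : l.foldl max a = a ∨ l.foldl max a ∈ l := by
  induction l generalizing a with
  | nil => exact Or.inl rfl
  | cons x l ih =>
    rw [List.foldl_cons]
    rcases ih (max a x) with h | h
    · rw [h]
      rcases le_total a x with hax | hax
      · rw [max_eq_right hax]; exact Or.inr List.mem_cons_self
      · rw [max_eq_left hax]; exact Or.inl rfl
    · exact Or.inr (List.mem_cons_of_mem x h)

/-- **The largest squared norm on codes** (the running maximum is `0` or an item).
[cite: AroraBarak2009, §1.3] -/
theorem maxNormSq_codeFP : CodeFP zmatE intE maxNormSq := by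
  have hmax : CodeFP (pairE intE intE) intE (fun t => max t.2 t.1) :=
    (intLe.comp ((snd _ _).pair (fst _ _))).ite (fst _ _) (snd _ _) |>.congr fun t => by
      by_cases h : t.2 ≤ t.1
      · rw [if_pos (decide_eq_true h), max_eq_right h]
      · rw [if_neg (by rw [decide_eq_true_iff]; exact h), max_eq_left (le_of_lt (not_le.1 h))]
  have hfold := foldl₀ (α := ℤ) (β := ℤ) (eα := intE) (eβ := intE) (step := fun a b => max b a) (b₀ := 0) hmax (X + 2)
    (fun l₁ l₂ => by
      simp only [eval_add, eval_X, eval_ofNat]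
      change (intE (l₁.foldl max 0)).length ≤ _
      rcases foldl_max_mem l₁ 0 with h | h
      · rw [h]; change (dpEnc 0).length ≤ _; rw [dpEnc_zero, length_boolPair]; simp
      · have := length_item_le_length_rawE intE (List.mem_append_left l₂ h)
        omega)
  exact ((hfold.comp (map₀ normSq_codeFP)).congr fun _ => rfl)

/-- **`better` on codes.** [cite: Regev2009, Lemma 3.17 (proof)] -/
theorem better_codeFP : CodeFP (pairE zmatE zmatE) zmatE (fun p => better p.1 p.2) := by
  have hlt : CodeFP (pairE zmatE zmatE) bitE (fun p => decide (maxNormSq p.1 < maxNormSq p.2)) :=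
    intLt.comp ((maxNormSq_codeFP.comp (fst _ _)).pair (maxNormSq_codeFP.comp (snd _ _)))
  refine (hlt.ite (fst _ _) (snd _ _)).congr fun p => ?_
  rw [better]
  by_cases h : maxNormSq p.1 < maxNormSq p.2
  · rw [if_pos (decide_eq_true h), if_pos h]
  · rw [if_neg (by rw [decide_eq_true_iff]; exact h), if_neg h]

/-- **`selectBest` on codes** (the incumbent is the fallback or a candidate, so its code is bounded
by the input). [cite: Regev2009, Lemma 3.17 (proof)] [cite: AroraBarak2009, §1.3] -/
theorem selectBest_codeFP : CodeFP (pairE zmatE (rawE zmatE)) zmatE (fun p => selectBest p.1 p.2) := by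
  have hstep : CodeFP (pairE zmatE (pairE zmatE zmatE)) zmatE (fun t => better t.2.1 t.2.2) := better_codeFP.comp (snd _ _)
  have hfold := foldl (σ := List (List ℤ)) (α := List (List ℤ)) (β := List (List ℤ)) (eσ := zmatE) (eα := zmatE)
    (eβ := zmatE) (step := fun _ C best => better C best) (init := fun c₀ => c₀) hstep (CodeFP.id _) X
    (fun c₀ l₁ l₂ => by
      simp only [eval_X, pairE_apply, length_boolPair]
      rcases selectBest_mem c₀ l₁ with h | h
      · change (rawE (rawE intE) (selectBest c₀ l₁)).length ≤ _
        rw [h]; omega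
      · change (rawE (rawE intE) (selectBest c₀ l₁)).length ≤ _
        have := length_item_le_length_rawE (rawE (rawE intE)) (List.mem_append_left l₂ h)
        omega)
  exact hfold.congr fun _ => rfl

/-! ### Filtering, candidates, the post-processing -/

/-- `filter` as `flatten ∘ map`. [folklore] -/
theorem flatten_map_ite {α : Type} (f : α → Bool) (l : List α) :
    (l.map fun a => if f a then [a] else []).flatten = l.filter f := by
  induction l with
  | nil => rfl
  | cons a l ih =>
    rw [List.map_cons, List.flatten_cons, ih, List.filter_cons]
    cases f a <;> simp

/-- **`filter` on codes**, for a test computed on codes with a context. [cite: AroraBarak2009, §1.3] -/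
theorem filter_codeFP {σ α : Type} {eσ : σ → List Bool} {eα : α → List Bool} {q : σ × α → Bool}
    (hq : CodeFP (pairE eσ eα) bitE q) :
    CodeFP (pairE eσ (rawE eα)) (rawE eα) (fun p => p.2.filter fun a => q (p.1, a)) := by
  have hitem : CodeFP (pairE eσ eα) (rawE eα) (fun t => if q t then [t.2] else []) :=
    hq.ite ((rawSingleton eα).comp (snd _ _)) (const _ [])
  have hmap := map (σ := σ) (eσ := eσ) (eα := eα) hitem
  refine ((flatten eα).comp hmap).congr fun p => ?_
  exact flatten_map_ite (fun a => q (p.1, a)) p.2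

/-- **The group candidate on codes.** [cite: Regev2009, Lemma 3.17 (proof)] -/
theorem groupCandidate_codeFP :
    CodeFP (pairE natE (pairE zmatE zmatE)) zmatE (fun t => groupCandidate detZ t.1 t.2.1 t.2.2) := by
  have hfilter := filter_codeFP (σ := List (List ℤ)) (eσ := zmatE) (eα := ivecE) memTest_codeFP
  -- `(n, B, S) ↦ (n, S.filter (memTest B))`
  have h := greedy_codeFP.comp ((fst natE (pairE zmatE zmatE)).pair (hfilter.comp (snd natE (pairE zmatE zmatE))))
  exact h.congr fun _ => rfl

/-- **The admissible candidates on codes.** [cite: Regev2009, Lemma 3.17 (proof)] -/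
theorem candidates_codeFP :
    CodeFP (pairE natE (pairE zmatE (rawE zmatE))) (rawE zmatE) (fun t => candidates detZ t.1 t.2.1 t.2.2) := by
  let iE := pairE natE (pairE zmatE (rawE zmatE))
  have pn : CodeFP iE natE (fun t => t.1) := fst _ _
  have pB : CodeFP iE zmatE (fun t => t.2.1) := (snd _ _).fst'
  have pG : CodeFP iE (rawE zmatE) (fun t => t.2.2) := (snd _ _).snd'
  -- the map of `groupCandidate` with context `(n, B)`
  have hg : CodeFP (pairE (pairE natE zmatE) zmatE) zmatE (fun q => groupCandidate detZ q.1.1 q.1.2 q.2) :=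
    (groupCandidate_codeFP.comp ((fst _ _).fst'.pair ((fst _ _).snd'.pair (snd _ _)))).congr fun _ => rfl
  have hmap := map (σ := ℕ × List (List ℤ)) (eσ := pairE natE zmatE) (eα := zmatE) hg
  have hcands : CodeFP iE (rawE zmatE) (fun t => t.2.2.map (groupCandidate detZ t.1 t.2.1)) :=
    (hmap.comp ((pn.pair pB).pair pG)).congr fun _ => rfl
  -- the filter by length with context `n`
  have hq : CodeFP (pairE natE zmatE) bitE (fun q => decide (q.2.length = q.1)) :=
    natEq.comp (((natLength ivecE).comp (snd _ _)).pair (fst _ _))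
  have hfilter := filter_codeFP (σ := ℕ) (eσ := natE) (eα := zmatE) hq
  exact ((hfilter.comp (pn.pair hcands)).congr fun _ => rfl)

/-- **The post-processing of Regev 2009, Lemma 3.17 is polynomial time on codes**: on the code of
`(n, B, Bl, Gs)` it returns the code of `RowSelect.post detZ n B Bl Gs`.
[cite: Regev2009, Lemma 3.17 (proof)] [cite: AroraBarak2009, §1.3] -/
theorem post_codeFP :
    CodeFP (pairE natE (pairE zmatE (pairE zmatE (rawE zmatE)))) zmatE
      (fun t => post detZ t.1 t.2.1 t.2.2.1 t.2.2.2) := by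
  let iE := pairE natE (pairE zmatE (pairE zmatE (rawE zmatE)))
  have pn : CodeFP iE natE (fun t => t.1) := fst _ _
  have pB : CodeFP iE zmatE (fun t => t.2.1) := (snd _ _).fst'
  have pBl : CodeFP iE zmatE (fun t => t.2.2.1) := (snd _ _).snd'.fst'
  have pG : CodeFP iE (rawE zmatE) (fun t => t.2.2.2) := (snd _ _).snd'.snd'
  have hc : CodeFP iE (rawE zmatE) (fun t => candidates detZ t.1 t.2.1 t.2.2.2) :=
    candidates_codeFP.comp (pn.pair (pB.pair pG))
  exact (selectBest_codeFP.comp (pBl.pair hc)).congr fun _ => rfl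

end RowSelectFP

end Literature.Computability.Complexity
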